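import Literature.MathematicalPhysics.QuantumFieldTheory.Balaban1983to89.B4Thm19ZeroBoxHolderRateUnif
import Literature.MathematicalPhysics.QuantumFieldTheory.Balaban1983to89.B4Thm19ZeroBoxHolderDual

/-!
# `Balaban1983to89.B4Thm19ZeroBoxHolderDualRateUnif` — the COLUMN («Dual») companion of [B4] (1.9) at `A = 0` on boxes
# (the mixed second difference `(G(x′,z+e_μ) − G(x′,z)) − (G(x,z+e_μ) − G(x,z))`, input of the [B6] Prop. 2.2 entry
# `‖ζG′∇*λ‖_α`) WITH THE PRINTED QUANTIFIER ORDER «δ₀ … depending on d, M only, c₀ on α also»: the chain of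
# `…B4Thm19ZeroBoxHolderDual` (`Gfine_blockRowLong_bound → step_termHT_bound → Gfine_rowwHT_bound →
# thm19Dual_zero_box_roww(_coeff)`) RE-THREADED (`_unif` twins; proofs = the originals with the `∃`-witnesses reordered)

statement-level skeleton of published theorems with citation tags; proofs where landed; nothing here is a claim about the Yang–Mills mass gap

T. Bałaban, *Regularity and decay of lattice Green's functions*, Commun. Math. Phys. **89** (1983) 571–597
[Balaban1983RegularityDecay] («[B4]»).  PDF held `paper:balaban1983-cmp89-regularity-decay` (journal page = PDF page + 570):
p. 573 [PDF 3] (Theorem, (1.9)), p. 582 [PDF 12] ((2.34)–(2.38)), p. 583 [PDF 13] ((2.39)).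

CITATION HEADER (lean-in-tree rule).  Cell `lit-balaban` (HOME `run/shared/lean/pub/lit-balaban/`), unit `lit-balaban-r03`
gen 13 (B6 fold owner; free-target protocol G.5-34(d): row **B4.Thm@573** cells, owner r01 notified; consumer row
**B6.Prop2.2**, entry 5 of (2.67)).  File 3 of the `_unif` re-threading (file 1 `…B4Lemma24HolderRateUnif`, file 2
`…B4Thm19ZeroBoxHolderRateUnif`).  A NEW LEAF on p21 g9's `…B4Thm19ZeroBoxHolderDual` (whose `Gfine_blockRowDiff_bound`,
`BmatColDiff_bound`, `weight_mul3_rowsub_coldiff`, `fwd` bookkeeping etc. are consumed BY NAME; its three PRIVATE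
plumbing lemmas `supNorm_blk_sub_blk_le`, `tele_le`, `holder_gain` are not importable and are COPIED here verbatim as
private lemmas, §0); NOTHING existing is modified.  THEOREMS ONLY — no definition, no `def … : Prop` fact.

WHAT IS PRINTED.  p. 573: «For α < 1 there exist positive constants δ₀, c₀, R₀ independent of A, k, Ω and depending on d,
M only, c₀ on α also»; p. 582 Lemma 2.4: «There exist positive constants c₀, δ₀, and for α < 1, there exists a constant
c₁».  The column companion is not displayed in [B4]; it is the same estimate for the transposed difference, used by [B6]
Prop. 2.2 for the entry `‖ζG′∇*λ‖_α` of (2.67) (p21's `…B4Thm19ZeroBoxHolderDual`, gap G-B6-21 of HOME/GAPS.md).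

WHY / WHAT.  As for file 2: the originals are stated `∀ α ∃ (δ₀, c₀)` although the proofs take the rate from `α`-free
inputs (`Gfine_blockRow_bound`, `Gfine_blockRowDiff_bound`, `BmatColDiff_bound`, `cov237_box_decay`, `boxOpR_L_inv_decay`);
this file repeats the proofs with the witnesses reordered:
* §1 `Gfine_blockRowLong_bound_unif` — `∃ κ ∀ α ∃ C` (here even `C` is `α`-free in the proof; `α` enters the weight only);
* §2 `step_termHT_bound_unif` — `∃ κ₀ ∀ α ∃ Θ(α) ∀ δ₀ ≤ κ₀`; `Gfine_rowwHT_bound_unif` — `∃ δ₀ ∀ α ∃ c₀(α)`;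
* §3 **`thm19Dual_zero_box_roww_unif`**, **`thm19Dual_zero_box_roww_coeff_unif`** — the column companion of (1.9) at
  `A = 0` on boxes with ONE `δ₀` for all `α`, in the form consumed by `…B6Ineq243HolderDualTwoLevelBox`.
HONEST SCOPE.  Exactly that of `…B4Thm19ZeroBoxHolderDual` (A = 0, boxes, `k ≥ 1`, windows; `δ₀` depends on
`(d, L, a₋, a₊, m²₊)`, `c₀` on these and `α`).  No new estimate — a change of quantifier order justified by the existing
proofs.  NOT summit progress.
-/

namespace Literature.MathematicalPhysics.QuantumFieldTheory.Balaban1983to89.B4Thm19ZeroBoxHolderDualRateUnif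

open Finset Matrix
open Literature.MathematicalPhysics.QuantumFieldTheory.Balaban1983to89.B4ContourShift
open Literature.MathematicalPhysics.QuantumFieldTheory.Balaban1983to89.B4Reflection242
open Literature.MathematicalPhysics.QuantumFieldTheory.Balaban1983to89.B4Green242Bridge
open Literature.MathematicalPhysics.QuantumFieldTheory.Balaban1983to89.B4BoxCov237
open Literature.MathematicalPhysics.QuantumFieldTheory.Balaban1983to89.B4Thm110ZeroBox
open Literature.MathematicalPhysics.QuantumFieldTheory.Balaban1983to89.B4Thm110ZeroBoxDeriv
open Literature.MathematicalPhysics.QuantumFieldTheory.Balaban1983to89.B4Thm19ZeroBoxHolder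
open Literature.MathematicalPhysics.QuantumFieldTheory.Balaban1983to89.B4Lemma22ZeroBoxDerivDual
open Literature.MathematicalPhysics.QuantumFieldTheory.Balaban1983to89.B4Thm19ZeroBoxHolderDual
open Literature.MathematicalPhysics.QuantumFieldTheory.Balaban1983to89.B4Thm19ZeroBoxHolderRateUnif
open B4StripSumsHolder (one_le_supNorm)
open B4Sect5Torus (IsPseudoDist SumBound Hyp56 rate rate_pos inv_decay)
open B4Sect5Proof (latticeConst latticeConst_nonneg latticeSum_le)

noncomputable section

variable {d : ℕ}

/-! ## §0 Private plumbing copied verbatim from `…B4Thm19ZeroBoxHolderDual` (private there, hence not importable) -/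

/-- block labels of nearby points are nearby: `|blk_b u − blk_b x|_∞ ≤ |u − x|_∞/b + 1` (verbatim private copy from
`…B4Thm19ZeroBoxHolderDual`). [folklore] -/
private theorem supNorm_blk_sub_blk_le {b : ℕ} (hb : 1 ≤ b) (u x : Fin (d + 1) → ℤ) :
    supNorm (blk b u - blk b x) ≤ supNorm (u - x) / b + 1 := by
  have hb0 : (0 : ℤ) < b := by exact_mod_cast hb
  have hbR : (0 : ℝ) < b := by exact_mod_cast hb
  refine supNorm_le_of_forall fun i => ?_
  have hux : (((|(u - x) i| : ℤ)) : ℝ) ≤ supNorm (u - x) := abs_le_supNorm _ i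
  rw [Pi.sub_apply] at hux
  have hβ : (blk b u - blk b x) i = u i / (b : ℤ) - x i / (b : ℤ) := rfl
  rw [hβ]
  have h1 : u i % (b : ℤ) + u i / (b : ℤ) * b = u i := Int.emod_add_ediv_mul (u i) b
  have h2 : x i % (b : ℤ) + x i / (b : ℤ) * b = x i := Int.emod_add_ediv_mul (x i) b
  have h3 : 0 ≤ u i % (b : ℤ) := Int.emod_nonneg (u i) hb0.ne'
  have h4 : u i % (b : ℤ) < b := Int.emod_lt_of_pos (u i) hb0
  have h5 : 0 ≤ x i % (b : ℤ) := Int.emod_nonneg (x i) hb0.ne'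
  have h6 : x i % (b : ℤ) < b := Int.emod_lt_of_pos (x i) hb0
  -- `b·|q_u − q_x| ≤ |u − x| + (b − 1) < |u − x| + b`
  have h7 : (b : ℤ) * |u i / (b : ℤ) - x i / (b : ℤ)| ≤ |u i - x i| + ((b : ℤ) - 1) := by
    have e : (b : ℤ) * (u i / (b : ℤ) - x i / (b : ℤ)) = (u i - x i) - (u i % (b : ℤ) - x i % (b : ℤ)) := by
      linear_combination h1 - h2
    have hrr : |u i % (b : ℤ) - x i % (b : ℤ)| ≤ (b : ℤ) - 1 := abs_le.2 ⟨by linarith, by linarith⟩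
    calc (b : ℤ) * |u i / (b : ℤ) - x i / (b : ℤ)| = |(b : ℤ) * (u i / (b : ℤ) - x i / (b : ℤ))| := by
          rw [abs_mul, abs_of_pos hb0]
      _ = |(u i - x i) - (u i % (b : ℤ) - x i % (b : ℤ))| := by rw [e]
      _ ≤ |u i - x i| + |u i % (b : ℤ) - x i % (b : ℤ)| := abs_sub _ _
      _ ≤ _ := by linarith
  have h8 : (b : ℝ) * (((|u i / (b : ℤ) - x i / (b : ℤ)| : ℤ)) : ℝ) ≤ (((|u i - x i| : ℤ)) : ℝ) + ((b : ℝ) - 1) := by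
    exact_mod_cast h7
  rw [div_add_one hbR.ne', le_div_iff₀ hbR]
  linarith

/-- **TELESCOPING ALONG A LATTICE PATH INSIDE A RECTANGLE** (pseudo-metric form): if every unit step `u → u + e_i` with
both ends in the rectangle `[lo, hi]` of the box costs at most `B`, then two points `a, b` of the rectangle with
`Σ_i|b_i − a_i| ≤ m` are at `Φ`-distance `≤ m·B` (verbatim private copy from `…B4Thm19ZeroBoxHolderDual`). [folklore] -/
private theorem tele_le {N' : Fin (d + 1) → ℕ} (Φ : ↥(boxDom N') → ↥(boxDom N') → ℝ)
    (hsymm : ∀ a b, Φ a b = Φ b a) (htri : ∀ a b c, Φ a c ≤ Φ a b + Φ b c) (hzero : ∀ a, Φ a a = 0)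
    (lo hi : Fin (d + 1) → ℤ) {B : ℝ} (hB0 : 0 ≤ B)
    (hB : ∀ (i : Fin (d + 1)) (u ue : ↥(boxDom N')), ue.1 = u.1 + Pi.single i 1 →
      (∀ j, lo j ≤ u.1 j) → (∀ j, ue.1 j ≤ hi j) → Φ u ue ≤ B) :
    ∀ (m : ℕ) (a b : ↥(boxDom N')), (∀ j, lo j ≤ a.1 j ∧ a.1 j ≤ hi j) → (∀ j, lo j ≤ b.1 j ∧ b.1 j ≤ hi j) →
      ∑ j, |b.1 j - a.1 j| ≤ (m : ℤ) → Φ a b ≤ m * B := by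
  intro m
  induction m with
  | zero =>
      intro a b ha hb hab
      have h0 : ∑ j, |b.1 j - a.1 j| = 0 :=
        le_antisymm (by exact_mod_cast hab) (Finset.sum_nonneg fun j _ => abs_nonneg _)
      have hba : b = a := by
        apply Subtype.ext
        funext j
        have := (Finset.sum_eq_zero_iff_of_nonneg fun j _ => abs_nonneg (b.1 j - a.1 j)).1 h0 j (Finset.mem_univ _)
        have := abs_eq_zero.1 this
        linarith
      rw [hba, hzero]
      simp
  | succ m ih =>
      intro a b ha hb hab
      by_cases heq : b = a
      · rw [heq, hzero]; positivity
      · have hex : ∃ i, a.1 i ≠ b.1 i := by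
          by_contra hall
          push Not at hall
          exact heq (Subtype.ext (funext fun j => (hall j).symm))
        obtain ⟨i, hine⟩ := hex
        have haB := mem_boxDom.1 a.2
        have hbB := mem_boxDom.1 b.2
        rcases lt_or_gt_of_ne hine with hlt | hgt
        · -- step up in direction `i`
          have hmem : a.1 + Pi.single i 1 ∈ boxDom N' := by
            rw [mem_boxDom]
            intro j
            by_cases hj : j = i
            · subst hj
              simp only [Pi.add_apply, Pi.single_eq_same]
              have := haB j; have := hbB j
              constructor <;> omega
            · simp only [Pi.add_apply, Pi.single_eq_of_ne hj, add_zero]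
              exact haB j
          obtain ⟨a₁, ha₁def⟩ : ∃ a₁ : ↥(boxDom N'), a₁ = ⟨a.1 + Pi.single i 1, hmem⟩ := ⟨_, rfl⟩
          have ha₁v : ∀ j, a₁.1 j = a.1 j + (Pi.single i (1 : ℤ) : Fin (d + 1) → ℤ) j := fun j => by
            rw [ha₁def]; rfl
          have ha₁ : ∀ j, lo j ≤ a₁.1 j ∧ a₁.1 j ≤ hi j := by
            intro j
            rw [ha₁v j]
            by_cases hj : j = i
            · subst hj
              rw [Pi.single_eq_same]
              have := (ha j).1; have := (hb j).2
              constructor <;> omega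
            · rw [Pi.single_eq_of_ne hj, add_zero]
              exact ha j
          have hsum : ∑ j, |b.1 j - a₁.1 j| ≤ (m : ℤ) := by
            have e : ∀ j, |b.1 j - a₁.1 j| = |b.1 j - a.1 j| - (Pi.single i (1 : ℤ) : Fin (d + 1) → ℤ) j := by
              intro j
              rw [ha₁v j]
              by_cases hj : j = i
              · subst hj
                rw [Pi.single_eq_same, abs_of_nonneg (by omega), abs_of_nonneg (by omega)]
                ring
              · rw [Pi.single_eq_of_ne hj, add_zero, sub_zero]
            rw [Finset.sum_congr rfl fun j _ => e j, Finset.sum_sub_distrib, Finset.sum_pi_single',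
              if_pos (Finset.mem_univ _)]
            push_cast at hab
            omega
          have h1 : Φ a a₁ ≤ B := hB i a a₁ (funext fun j => ha₁v j) (fun j => (ha j).1) (fun j => (ha₁ j).2)
          have h2 : Φ a₁ b ≤ m * B := ih a₁ b ha₁ hb hsum
          calc Φ a b ≤ Φ a a₁ + Φ a₁ b := htri _ _ _
            _ ≤ B + m * B := add_le_add h1 h2
            _ = ((m + 1 : ℕ) : ℝ) * B := by push_cast; ring
        · -- step down in direction `i`
          have hmem : a.1 - Pi.single i 1 ∈ boxDom N' := by
            rw [mem_boxDom]
            intro j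
            by_cases hj : j = i
            · subst hj
              simp only [Pi.sub_apply, Pi.single_eq_same]
              have := haB j; have := hbB j
              constructor <;> omega
            · simp only [Pi.sub_apply, Pi.single_eq_of_ne hj, sub_zero]
              exact haB j
          obtain ⟨a₁, ha₁def⟩ : ∃ a₁ : ↥(boxDom N'), a₁ = ⟨a.1 - Pi.single i 1, hmem⟩ := ⟨_, rfl⟩
          have ha₁v : ∀ j, a₁.1 j = a.1 j - (Pi.single i (1 : ℤ) : Fin (d + 1) → ℤ) j := fun j => by
            rw [ha₁def]; rfl
          have ha₁ : ∀ j, lo j ≤ a₁.1 j ∧ a₁.1 j ≤ hi j := by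
            intro j
            rw [ha₁v j]
            by_cases hj : j = i
            · subst hj
              rw [Pi.single_eq_same]
              have := (ha j).2; have := (hb j).1
              constructor <;> omega
            · rw [Pi.single_eq_of_ne hj, sub_zero]
              exact ha j
          have hsum : ∑ j, |b.1 j - a₁.1 j| ≤ (m : ℤ) := by
            have e : ∀ j, |b.1 j - a₁.1 j| = |b.1 j - a.1 j| - (Pi.single i (1 : ℤ) : Fin (d + 1) → ℤ) j := by
              intro j
              rw [ha₁v j]
              by_cases hj : j = i
              · subst hj
                rw [Pi.single_eq_same, abs_of_nonpos (by omega), abs_of_nonpos (by omega)]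
                ring
              · rw [Pi.single_eq_of_ne hj, sub_zero, sub_zero]
            rw [Finset.sum_congr rfl fun j _ => e j, Finset.sum_sub_distrib, Finset.sum_pi_single',
              if_pos (Finset.mem_univ _)]
            push_cast at hab
            omega
          have hae : a.1 = a₁.1 + Pi.single i 1 := by
            funext j; rw [Pi.add_apply, ha₁v j]; ring
          have h1 : Φ a a₁ ≤ B := by
            rw [hsymm]
            exact hB i a₁ a hae (fun j => (ha₁ j).1) (fun j => (ha j).2)
          have h2 : Φ a₁ b ≤ m * B := ih a₁ b ha₁ hb hsum
          calc Φ a b ≤ Φ a a₁ + Φ a₁ b := htri _ _ _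
            _ ≤ B + m * B := add_le_add h1 h2
            _ = ((m + 1 : ℕ) : ℝ) * B := by push_cast; ring

/-- the Hölder weight against the block scale: for `0 < s ≤ b`, `σ ≥ 1`, `0 ≤ α ≤ 1`,
`(σb/s)^α·(s/(σb)) = (s/(σb))^{1−α} ≤ σ^{−(1−α)} = σ^α·σ^{-1}` — the `(L^jη)^{1−α}` of [B4] (2.38) (verbatim private copy
from `…B4Thm19ZeroBoxHolderDual`). [folklore] -/
private theorem holder_gain {s b σ α : ℝ} (hs : 0 < s) (hsb : s ≤ b) (hσ : 1 ≤ σ) (hα1 : α ≤ 1) :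
    (σ * b / s) ^ α * (s / (σ * b)) ≤ σ ^ α * σ⁻¹ := by
  have hb : 0 < b := lt_of_lt_of_le hs hsb
  have hσ0 : 0 < σ := lt_of_lt_of_le one_pos hσ
  have hn : 0 < σ * b := mul_pos hσ0 hb
  have ht : 0 < s / (σ * b) := div_pos hs hn
  have e1 : (σ * b / s) ^ α * (s / (σ * b)) = (s / (σ * b)) ^ (1 - α) := by
    rw [show σ * b / s = (s / (σ * b))⁻¹ by rw [inv_div], Real.inv_rpow ht.le, Real.rpow_sub ht,
      Real.rpow_one]
    field_simp
  rw [e1]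
  have h2 : s / (σ * b) ≤ σ⁻¹ := by
    rw [div_le_iff₀ hn, inv_mul_cancel_left₀ hσ0.ne']
    exact hsb
  calc (s / (σ * b)) ^ (1 - α) ≤ (σ⁻¹) ^ (1 - α) := Real.rpow_le_rpow ht.le h2 (by linarith)
    _ = σ ^ α * σ⁻¹ := by
        rw [Real.inv_rpow hσ0.le, Real.rpow_sub hσ0, Real.rpow_one]
        field_simp

/-! ## §1 The long row difference with an `α`-free rate -/

set_option maxHeartbeats 1600000 in
/-- **Hölder-weighted long row difference of `A_j = 𝒢_jQ_j^*` on the fine box, rate uniform in `α`** — `B4Thm19ZeroBoxHolderDual.Gfine_blockRowLong_bound` in the order `∃ κ ∀ α ∃ C` (its rate `min κ κ′` and even its constant come from the `α`-free `Gfine_blockRow_bound`/`Gfine_blockRowDiff_bound`; `α` enters only the weight). [cite: Balaban1983RegularityDecay, Lemma 2.4 (2.35)–(2.36) p.582, (2.38) p.582] -/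
theorem Gfine_blockRowLong_bound_unif (d ℓ : ℕ) (hℓ : 1 ≤ ℓ) (aminus aplus m2plus : ℝ) (ha : 0 < aminus) :
    ∃ κ : ℝ, 0 < κ ∧ ∀ (α : ℝ), 0 ≤ α → α < 1 → ∃ C : ℝ, 0 ≤ C ∧ ∀ (k j : ℕ), 1 ≤ j → ∀ (hj : j + 1 ≤ k), ∀ (a m2 : ℝ), aminus ≤ a → a ≤ aplus →
      0 ≤ m2 → m2 ≤ m2plus → ∀ (M : Fin (d + 1) → ℕ), (∀ i, 1 ≤ M i) →
        ∀ (x x' : ↥(boxDom (Nf ℓ k M))), x'.1 ≠ x.1 →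
        ∀ (y : Fin (d + 1) → ℤ), y ∈ boxDom (Mj ℓ k M j) →
          ((((ℓ + 1) ^ k : ℕ) : ℝ) / supNorm (x'.1 - x.1)) ^ α *
            |∑ x'' : ↥(boxDom (Nf ℓ k M)),
              (if blk (bj ℓ j) x''.1 = y then Gfine ℓ k M j a m2 x' x'' - Gfine ℓ k M j a m2 x x'' else 0)|
            ≤ sc ℓ k j ^ α * (sc ℓ k j ^ 2)⁻¹ * C *
                Real.exp (-(κ * min (supNorm (blk (bj ℓ j) x.1 - y)) (supNorm (blk (bj ℓ j) x'.1 - y)))) := by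
  obtain ⟨κ, C₁, hκ, hC₁, hR⟩ := Gfine_blockRow_bound d ℓ hℓ aminus aplus m2plus ha
  obtain ⟨κ', C', hκ', hC', hDf⟩ := Gfine_blockRowDiff_bound d ℓ hℓ aminus aplus m2plus ha
  refine ⟨min κ κ', lt_min hκ hκ', fun α hα0 hα1 => ⟨2 * C₁ + ((d : ℝ) + 1) * C' * Real.exp (2 * κ'), by positivity, ?_⟩⟩
  intro k j hj1 hj a m2 h1 h2 h3 h4 M hM x x' hne y hy
  have hb1 : 1 ≤ bj ℓ j := bj_pos ℓ j
  have hbR : (0 : ℝ) < ((bj ℓ j : ℕ) : ℝ) := by exact_mod_cast hb1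
  have hσ1 : 1 ≤ sc ℓ k j := one_le_sc ℓ k j
  have hσ0 : 0 < sc ℓ k j := sc_pos ℓ k j
  have hσα : 0 ≤ sc ℓ k j ^ α := Real.rpow_nonneg hσ0.le α
  have hs2 : 0 < (sc ℓ k j ^ 2)⁻¹ := inv_pos.2 (pow_pos hσ0 2)
  have hnR : ((((ℓ + 1) ^ k : ℕ)) : ℝ) = sc ℓ k j * ((bj ℓ j : ℕ) : ℝ) := Lk_eq_sc_mul_bj (by omega)
  have hn0 : (0 : ℝ) < (((ℓ + 1) ^ k : ℕ) : ℝ) := by rw [hnR]; positivity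
  have hs1 : 1 ≤ supNorm (x'.1 - x.1) := one_le_supNorm (sub_ne_zero.2 hne)
  have hs0 : 0 < supNorm (x'.1 - x.1) := lt_of_lt_of_le one_pos hs1
  have hW0 : 0 ≤ ((((ℓ + 1) ^ k : ℕ) : ℝ) / supNorm (x'.1 - x.1)) ^ α :=
    Real.rpow_nonneg (div_nonneg hn0.le hs0.le) α
  -- the block-row sum as a function of the row
  set F : ↥(boxDom (Nf ℓ k M)) → ℝ := fun p =>
    ∑ x'' : ↥(boxDom (Nf ℓ k M)), (if blk (bj ℓ j) x''.1 = y then Gfine ℓ k M j a m2 p x'' else 0) with hF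
  have hsum : ∑ x'' : ↥(boxDom (Nf ℓ k M)),
      (if blk (bj ℓ j) x''.1 = y then Gfine ℓ k M j a m2 x' x'' - Gfine ℓ k M j a m2 x x'' else 0) = F x' - F x := by
    rw [hF]
    simp only
    rw [← Finset.sum_sub_distrib]
    refine Finset.sum_congr rfl fun x'' _ => ?_
    split_ifs <;> ring
  rw [hsum]
  -- the minimum of the two block distances
  set mn : ℝ := min (supNorm (blk (bj ℓ j) x.1 - y)) (supNorm (blk (bj ℓ j) x'.1 - y)) with hmn
  have hmn0 : 0 ≤ mn := le_min (supNorm_nonneg _) (supNorm_nonneg _)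
  have hex : ∀ t : ℝ, mn ≤ t → Real.exp (-(κ * t)) ≤ Real.exp (-(min κ κ' * mn)) := by
    intro t ht
    have := min_le_left κ κ'
    exact Real.exp_le_exp.2 (by nlinarith [lt_min hκ hκ'])
  have hex' : ∀ t : ℝ, mn ≤ t → Real.exp (-(κ' * t)) ≤ Real.exp (-(min κ κ' * mn)) := by
    intro t ht
    have := min_le_right κ κ'
    exact Real.exp_le_exp.2 (by nlinarith [lt_min hκ hκ'])
  have hCtot : 0 ≤ 2 * C₁ + ((d : ℝ) + 1) * C' * Real.exp (2 * κ') := by positivity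
  rcases le_or_gt (((bj ℓ j : ℕ) : ℝ)) (supNorm (x'.1 - x.1)) with hfar | hnear
  · -- FAR: `|x′ − x| ≥ b_j`; the weight is `≤ s_j^α`, the two rows are bounded separately
    have hW : ((((ℓ + 1) ^ k : ℕ) : ℝ) / supNorm (x'.1 - x.1)) ^ α ≤ sc ℓ k j ^ α := by
      refine Real.rpow_le_rpow (div_nonneg hn0.le hs0.le) ?_ hα0
      rw [div_le_iff₀ hs0, hnR]
      exact mul_le_mul_of_nonneg_left hfar hσ0.le
    have h1' := hR k j hj1 hj a m2 h1 h2 h3 h4 M hM x' y hy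
    have h2' := hR k j hj1 hj a m2 h1 h2 h3 h4 M hM x y hy
    have hFx' : |F x'| ≤ (sc ℓ k j ^ 2)⁻¹ * C₁ * Real.exp (-(min κ κ' * mn)) :=
      h1'.trans (mul_le_mul_of_nonneg_left (hex _ (min_le_right _ _)) (mul_nonneg hs2.le hC₁))
    have hFx : |F x| ≤ (sc ℓ k j ^ 2)⁻¹ * C₁ * Real.exp (-(min κ κ' * mn)) :=
      h2'.trans (mul_le_mul_of_nonneg_left (hex _ (min_le_left _ _)) (mul_nonneg hs2.le hC₁))
    have hdiff : |F x' - F x| ≤ 2 * ((sc ℓ k j ^ 2)⁻¹ * C₁ * Real.exp (-(min κ κ' * mn))) := by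
      calc |F x' - F x| ≤ |F x'| + |F x| := abs_sub _ _
        _ ≤ _ := by linarith
    calc ((((ℓ + 1) ^ k : ℕ) : ℝ) / supNorm (x'.1 - x.1)) ^ α * |F x' - F x|
        ≤ sc ℓ k j ^ α * (2 * ((sc ℓ k j ^ 2)⁻¹ * C₁ * Real.exp (-(min κ κ' * mn)))) :=
          mul_le_mul hW hdiff (abs_nonneg _) hσα
      _ = sc ℓ k j ^ α * (sc ℓ k j ^ 2)⁻¹ * (2 * C₁) * Real.exp (-(min κ κ' * mn)) := by ring
      _ ≤ sc ℓ k j ^ α * (sc ℓ k j ^ 2)⁻¹ * (2 * C₁ + ((d : ℝ) + 1) * C' * Real.exp (2 * κ')) *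
            Real.exp (-(min κ κ' * mn)) := by
          have : 0 ≤ ((d : ℝ) + 1) * C' * Real.exp (2 * κ') := by positivity
          have h0 : 0 ≤ sc ℓ k j ^ α * (sc ℓ k j ^ 2)⁻¹ * Real.exp (-(min κ κ' * mn)) := by positivity
          nlinarith
  · -- NEAR: `|x′ − x| < b_j`; telescoping inside the rectangle spanned by `x, x′`
    set lo : Fin (d + 1) → ℤ := fun i => min (x.1 i) (x'.1 i) with hlo
    set hi : Fin (d + 1) → ℤ := fun i => max (x.1 i) (x'.1 i) with hhi
    -- every point of the rectangle is within `|x′ − x|` of `x`, hence in a neighbouring block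
    have hrect : ∀ u : ↥(boxDom (Nf ℓ k M)), (∀ i, lo i ≤ u.1 i) → (∀ i, u.1 i ≤ hi i) →
        supNorm (u.1 - x.1) ≤ supNorm (x'.1 - x.1) := by
      intro u hl hh
      refine supNorm_le_of_forall fun i => ?_
      have h1 := hl i
      have h2 := hh i
      simp only [hlo, hhi] at h1 h2
      have hxi : (((|(x'.1 - x.1) i| : ℤ)) : ℝ) ≤ supNorm (x'.1 - x.1) := abs_le_supNorm _ i
      have hle : |(u.1 - x.1) i| ≤ |(x'.1 - x.1) i| := by
        simp only [Pi.sub_apply]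
        rw [abs_le]
        constructor
        · rcases le_total (x.1 i) (x'.1 i) with h | h
          · rw [min_eq_left h] at h1; have := le_abs_self (x'.1 i - x.1 i); omega
          · rw [min_eq_right h] at h1; have := neg_abs_le (x'.1 i - x.1 i); rw [abs_sub_comm] at this ⊢; omega
        · rcases le_total (x.1 i) (x'.1 i) with h | h
          · rw [max_eq_right h] at h2; have := le_abs_self (x'.1 i - x.1 i); omega
          · rw [max_eq_left h] at h2; have := abs_nonneg (x'.1 i - x.1 i); omega
      exact le_trans (by exact_mod_cast hle) hxi
    have hblk : ∀ u : ↥(boxDom (Nf ℓ k M)), (∀ i, lo i ≤ u.1 i) → (∀ i, u.1 i ≤ hi i) →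
        Real.exp (-(κ' * supNorm (blk (bj ℓ j) u.1 - y)))
          ≤ Real.exp (2 * κ') * Real.exp (-(κ' * supNorm (blk (bj ℓ j) x.1 - y))) := by
      intro u hl hh
      have h1 := supNorm_blk_sub_blk_le hb1 x.1 u.1
      have h2 : supNorm (x.1 - u.1) ≤ supNorm (x'.1 - x.1) := by
        rw [← neg_sub u.1 x.1, B4TorusKernel.supNorm_neg]; exact hrect u hl hh
      have h3 : supNorm (x.1 - u.1) / ((bj ℓ j : ℕ) : ℝ) ≤ 1 := by
        rw [div_le_one hbR]; linarith
      have h4 : supNorm (blk (bj ℓ j) x.1 - y) ≤ supNorm (blk (bj ℓ j) x.1 - blk (bj ℓ j) u.1)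
          + supNorm (blk (bj ℓ j) u.1 - y) := supNorm_sub_le_sub_add_sub _ _ _
      rw [← Real.exp_add]
      exact Real.exp_le_exp.2 (by nlinarith)
    -- one unit step costs `B`
    set B : ℝ := ((((ℓ + 1) ^ k : ℕ) : ℝ))⁻¹ * ((sc ℓ k j)⁻¹ * C' *
      (Real.exp (2 * κ') * Real.exp (-(κ' * supNorm (blk (bj ℓ j) x.1 - y))))) with hB
    have hB0 : 0 ≤ B := by positivity
    have hstep : ∀ (i : Fin (d + 1)) (u ue : ↥(boxDom (Nf ℓ k M))), ue.1 = u.1 + Pi.single i 1 →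
        (∀ j, lo j ≤ u.1 j) → (∀ j, ue.1 j ≤ hi j) → |F u - F ue| ≤ B := by
      intro i u ue hue hl hh
      have hu_hi : ∀ j', u.1 j' ≤ hi j' := by
        intro j'
        have := hh j'
        rw [hue] at this
        by_cases hj' : j' = i
        · subst hj'; simp only [Pi.add_apply, Pi.single_eq_same] at this; omega
        · simp only [Pi.add_apply, Pi.single_eq_of_ne hj', add_zero] at this; exact this
      have hd := hDf k j hj1 hj a m2 h1 h2 h3 h4 M hM i u ue hue y hy
      have hsum' : ∑ x'' : ↥(boxDom (Nf ℓ k M)),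
          (if blk (bj ℓ j) x''.1 = y then Gfine ℓ k M j a m2 ue x'' - Gfine ℓ k M j a m2 u x'' else 0)
          = F ue - F u := by
        rw [hF]
        simp only
        rw [← Finset.sum_sub_distrib]
        refine Finset.sum_congr rfl fun x'' _ => ?_
        split_ifs <;> ring
      rw [hsum', abs_mul, abs_of_pos hn0] at hd
      rw [abs_sub_comm, hB]
      calc |F ue - F u| = ((((ℓ + 1) ^ k : ℕ) : ℝ))⁻¹ * ((((ℓ + 1) ^ k : ℕ) : ℝ) * |F ue - F u|) := by
            field_simp
        _ ≤ ((((ℓ + 1) ^ k : ℕ) : ℝ))⁻¹ *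
            ((sc ℓ k j)⁻¹ * C' * Real.exp (-(κ' * supNorm (blk (bj ℓ j) u.1 - y)))) :=
          mul_le_mul_of_nonneg_left hd (inv_pos.2 hn0).le
        _ ≤ _ := by
          refine mul_le_mul_of_nonneg_left (mul_le_mul_of_nonneg_left (hblk u hl hu_hi) ?_) (inv_pos.2 hn0).le
          exact mul_nonneg (inv_pos.2 hσ0).le hC'
    -- telescoping
    obtain ⟨m, hm⟩ : ∃ m : ℕ, (m : ℤ) = ∑ i, |x'.1 i - x.1 i| :=
      ⟨(∑ i, |x'.1 i - x.1 i|).toNat, Int.toNat_of_nonneg (Finset.sum_nonneg fun i _ => abs_nonneg _)⟩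
    have hmR : (m : ℝ) ≤ ((d : ℝ) + 1) * supNorm (x'.1 - x.1) := by
      have h1 : ((m : ℤ) : ℝ) = ∑ i, (((|x'.1 i - x.1 i| : ℤ)) : ℝ) := by rw [hm]; push_cast; rfl
      have h2 : ∑ i : Fin (d + 1), (((|x'.1 i - x.1 i| : ℤ)) : ℝ) ≤ ∑ _i : Fin (d + 1), supNorm (x'.1 - x.1) :=
        Finset.sum_le_sum fun i _ => abs_le_supNorm (x'.1 - x.1) i
      rw [Finset.sum_const, Finset.card_univ, Fintype.card_fin, nsmul_eq_mul] at h2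
      have h3 : (m : ℝ) = ((m : ℤ) : ℝ) := by norm_cast
      rw [h3, h1]
      push_cast at h2 ⊢
      linarith
    have htele := tele_le (fun p q => |F p - F q|) (fun p q => abs_sub_comm _ _)
      (fun p q r => abs_sub_le _ _ _) (fun p => by simp) lo hi hB0 hstep m x x'
      (fun i => ⟨min_le_left _ _, le_max_left _ _⟩) (fun i => ⟨min_le_right _ _, le_max_right _ _⟩)
      (by rw [hm])
    rw [abs_sub_comm] at htele
    -- the Hölder weight against the block scale
    have hgain := holder_gain hs0 hnear.le hσ1 hα1.le
    rw [← hnR] at hgain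
    calc ((((ℓ + 1) ^ k : ℕ) : ℝ) / supNorm (x'.1 - x.1)) ^ α * |F x' - F x|
        ≤ ((((ℓ + 1) ^ k : ℕ) : ℝ) / supNorm (x'.1 - x.1)) ^ α * ((m : ℝ) * B) :=
          mul_le_mul_of_nonneg_left htele hW0
      _ ≤ ((((ℓ + 1) ^ k : ℕ) : ℝ) / supNorm (x'.1 - x.1)) ^ α * ((((d : ℝ) + 1) * supNorm (x'.1 - x.1)) * B) :=
          mul_le_mul_of_nonneg_left (mul_le_mul_of_nonneg_right hmR hB0) hW0
      _ = (((((ℓ + 1) ^ k : ℕ) : ℝ) / supNorm (x'.1 - x.1)) ^ α *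
            (supNorm (x'.1 - x.1) / (((ℓ + 1) ^ k : ℕ) : ℝ))) *
            ((sc ℓ k j)⁻¹ * (((d : ℝ) + 1) * C' * Real.exp (2 * κ')) *
              Real.exp (-(κ' * supNorm (blk (bj ℓ j) x.1 - y)))) := by
          rw [hB]
          field_simp
      _ ≤ (sc ℓ k j ^ α * (sc ℓ k j)⁻¹) *
            ((sc ℓ k j)⁻¹ * (((d : ℝ) + 1) * C' * Real.exp (2 * κ')) * Real.exp (-(min κ κ' * mn))) := by
          refine mul_le_mul hgain ?_ (by positivity) (mul_nonneg hσα (inv_pos.2 hσ0).le)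
          refine mul_le_mul_of_nonneg_left (hex' _ (min_le_left _ _)) (by positivity)
      _ = sc ℓ k j ^ α * (sc ℓ k j ^ 2)⁻¹ * (((d : ℝ) + 1) * C' * Real.exp (2 * κ')) *
            Real.exp (-(min κ κ' * mn)) := by
          field_simp
      _ ≤ sc ℓ k j ^ α * (sc ℓ k j ^ 2)⁻¹ * (2 * C₁ + ((d : ℝ) + 1) * C' * Real.exp (2 * κ')) *
            Real.exp (-(min κ κ' * mn)) := by
          have h0 : 0 ≤ sc ℓ k j ^ α * (sc ℓ k j ^ 2)⁻¹ * Real.exp (-(min κ κ' * mn)) := by positivity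
          nlinarith

/-! ## §2 The column induction with an `α`-free rate cap -/

section StepBound

variable {ℓ k j : ℕ} {M : Fin (d + 1) → ℕ} {a m2 : ℝ}

set_option maxHeartbeats 1600000 in
/-- **The column («Dual») Hölder-differenced step bound of the (2.34)/(2.38) induction, admissible rate cap uniform in `α`** — `B4Thm19ZeroBoxHolderDual.step_termHT_bound` in the order `∃ κ₀ ∀ α ∃ Θ(α) ∀ δ₀ ≤ κ₀`. [cite: Balaban1983RegularityDecay, (2.34) p.582, (2.38)–(2.39) pp.582–583] -/
theorem step_termHT_bound_unif (d ℓ : ℕ) (hℓ : 1 ≤ ℓ) (amin aplus m2plus : ℝ) (ha : 0 < amin) :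
    ∃ κ₀ : ℝ, 0 < κ₀ ∧ ∀ (α : ℝ), 0 ≤ α → α < 1 → ∃ Θ : ℝ, 0 ≤ Θ ∧ ∀ (δ₀ : ℝ), 0 ≤ δ₀ → δ₀ ≤ κ₀ →
      ∀ (k j : ℕ), 1 ≤ j → ∀ (hj : j + 1 ≤ k), ∀ (a m2 : ℝ), amin ≤ a → a ≤ aplus → 0 ≤ m2 →
        m2 ≤ m2plus → ∀ (M : Fin (d + 1) → ℕ), (∀ i, 1 ≤ M i) →
        ∀ (μ : Fin (d + 1)) (x x' : ↥(boxDom (Nf ℓ k M))), x'.1 ≠ x.1 →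
          wsum2 δ₀ ((ℓ + 1) ^ k) x x' (fun z => ((((ℓ + 1) ^ k : ℕ) : ℝ) / supNorm (x'.1 - x.1)) ^ α *
              ((((ℓ + 1) ^ k : ℕ) : ℝ) *
                (((Gfine ℓ k M (j + 1) a m2 - Gfine ℓ k M j a m2) x' (fwd (Nf ℓ k M) μ z)
                    - (Gfine ℓ k M (j + 1) a m2 - Gfine ℓ k M j a m2) x' z)
                  - ((Gfine ℓ k M (j + 1) a m2 - Gfine ℓ k M j a m2) x (fwd (Nf ℓ k M) μ z)
                    - (Gfine ℓ k M (j + 1) a m2 - Gfine ℓ k M j a m2) x z))))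
            ≤ Θ * Real.exp δ₀ * (sc ℓ k j ^ α * (sc ℓ k j)⁻¹) := by
  obtain ⟨κ, hκ, hLA⟩ := Gfine_blockRowLong_bound_unif d ℓ hℓ amin aplus m2plus ha
  obtain ⟨κ', C', hκ', hC', hDc⟩ := BmatColDiff_bound d ℓ hℓ amin aplus m2plus ha
  obtain ⟨δ, c₂, hδ, hc₂, hCov⟩ := cov237_box_decay d ℓ hℓ (amin * (1 - ((((ℓ : ℝ) + 1)) ^ 2)⁻¹)) aplus
    m2plus amin aplus (aminus'_pos hℓ ha) ha
  have hK0 : ∀ t : ℝ, 0 < t → 0 ≤ latticeConst (d + 1) t := fun t ht => latticeConst_nonneg _ ht.le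
  have hκ₁ : 0 < min κ κ' := lt_min hκ hκ'
  have hKκ := hK0 _ (half_pos hκ₁)
  have hKδ := hK0 _ (half_pos hδ)
  refine ⟨min (min κ κ') δ / 2, by positivity, fun α hα0 hα1 => ?_⟩
  obtain ⟨C₁, hC₁, hL⟩ := hLA α hα0 hα1
  refine ⟨2 * (aplus ^ 2 * (C₁ * c₂ * C')
      * (latticeConst (d + 1) (min κ κ' / 2) * latticeConst (d + 1) (δ / 2)
          * latticeConst (d + 1) (min κ κ' / 2))), ?_, ?_⟩
  · exact mul_nonneg (by norm_num) (mul_nonneg (mul_nonneg (sq_nonneg _)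
      (mul_nonneg (mul_nonneg hC₁ hc₂.le) hC')) (mul_nonneg (mul_nonneg hKκ hKδ) hKκ))
  intro δ₀ hδ0 hδ1 k j hj1 hj a m2 h1 h2 h3 h4 M hM μ x x' hne
  have ha0 : 0 < a := lt_of_lt_of_le ha h1
  obtain ⟨hw1, hw2, hapos⟩ := aSeq_window hℓ ha h1 h2 hj1
  have hs : 0 < sc ℓ k j ^ 2 := pow_pos (sc_pos ℓ k j) 2
  have hsi : 0 < (sc ℓ k j ^ 2)⁻¹ := inv_pos.2 hs
  have hs1i : 0 < (sc ℓ k j)⁻¹ := inv_pos.2 (sc_pos ℓ k j)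
  have hsα : 0 ≤ sc ℓ k j ^ α := Real.rpow_nonneg (sc_pos ℓ k j).le α
  have hP0 : 0 ≤ sc ℓ k j ^ α * (sc ℓ k j ^ 2)⁻¹ * C₁ := mul_nonneg (mul_nonneg hsα hsi.le) hC₁
  have hsc0 : sc ℓ k j ≠ 0 := (sc_pos ℓ k j).ne'
  have hm' : 0 ≤ m2 / sc ℓ k j ^ 2 := div_nonneg h3 hs.le
  have hm'' : m2 / sc ℓ k j ^ 2 ≤ m2plus :=
    (div_le_self h3 (one_le_pow₀ (one_le_sc ℓ k j))).trans h4
  have hb1 : 1 ≤ bj ℓ j := bj_pos ℓ j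
  have hbD : (0 : ℝ) < ((bj ℓ j : ℕ) : ℝ) ^ (d + 1) := by positivity
  have hδκ : δ₀ ≤ min κ κ' / 2 := hδ1.trans (by linarith [min_le_left (min κ κ') δ])
  have hδδ : δ₀ ≤ δ / 2 := hδ1.trans (by linarith [min_le_right (min κ κ') δ])
  -- the Hölder weight of the pair
  set W : ℝ := ((((ℓ + 1) ^ k : ℕ) : ℝ) / supNorm (x'.1 - x.1)) ^ α with hW
  have hσ1 : 1 ≤ supNorm (x'.1 - x.1) := one_le_supNorm (sub_ne_zero.2 hne)
  have hW0 : 0 ≤ W := Real.rpow_nonneg (div_nonneg (Nat.cast_nonneg _) (le_trans zero_le_one hσ1)) α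
  -- the weighted long row difference of the block-row sums
  set gL : ↥(boxDom (Mj ℓ k M j)) → ℝ := fun y => W * (Amat ℓ k M j a m2 x' y - Amat ℓ k M j a m2 x y)
    with hgL
  have hg : ∀ y : ↥(boxDom (Mj ℓ k M j)), |gL y|
      ≤ sc ℓ k j ^ α * (sc ℓ k j ^ 2)⁻¹ * C₁ *
          Real.exp (-(min κ κ' *
            min (supNorm (blk (bj ℓ j) x.1 - y.1)) (supNorm (blk (bj ℓ j) x'.1 - y.1)))) := by
    intro y
    have hAd : Amat ℓ k M j a m2 x' y - Amat ℓ k M j a m2 x y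
        = ∑ x'', (if blk (bj ℓ j) x''.1 = y.1 then
            Gfine ℓ k M j a m2 x' x'' - Gfine ℓ k M j a m2 x x'' else 0) := by
      simp only [Amat, Matrix.mul_apply, QksM, Matrix.of_apply, mul_ite, mul_one, mul_zero]
      rw [← Finset.sum_sub_distrib]
      refine Finset.sum_congr rfl fun x'' _ => ?_
      split_ifs <;> ring
    have habs : |gL y| = W * |∑ x'', (if blk (bj ℓ j) x''.1 = y.1 then
            Gfine ℓ k M j a m2 x' x'' - Gfine ℓ k M j a m2 x x'' else 0)| := by
      rw [hgL]
      dsimp only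
      rw [hAd, abs_mul, abs_of_nonneg hW0]
    rw [habs]
    exact (hL k j hj1 hj a m2 h1 h2 h3 h4 M hM x x' hne y.1 y.2).trans
      (mul_le_mul_of_nonneg_left (exp_rate_mono (min_le_left κ κ')
        (le_min (supNorm_nonneg _) (supNorm_nonneg _))) hP0)
  -- the split according to the nearer centre
  set g₁ : ↥(boxDom (Mj ℓ k M j)) → ℝ := fun y =>
    if supNorm (blk (bj ℓ j) x.1 - y.1) ≤ supNorm (blk (bj ℓ j) x'.1 - y.1) then gL y else 0 with hg₁
  set g₂ : ↥(boxDom (Mj ℓ k M j)) → ℝ := fun y =>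
    if supNorm (blk (bj ℓ j) x.1 - y.1) ≤ supNorm (blk (bj ℓ j) x'.1 - y.1) then 0 else gL y with hg₂
  have hg12 : ∀ y, gL y = g₁ y + g₂ y := by
    intro y
    simp only [hg₁, hg₂]
    split_ifs <;> simp
  have hg1 : ∀ y, |g₁ y| ≤ sc ℓ k j ^ α * (sc ℓ k j ^ 2)⁻¹ * C₁ *
      Real.exp (-(min κ κ' * supNorm (blk (bj ℓ j) x.1 - y.1))) := by
    intro y
    simp only [hg₁]
    split_ifs with hle
    · refine (hg y).trans (le_of_eq ?_)
      rw [min_eq_left hle]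
    · rw [abs_zero]
      positivity
  have hg2 : ∀ y, |g₂ y| ≤ sc ℓ k j ^ α * (sc ℓ k j ^ 2)⁻¹ * C₁ *
      Real.exp (-(min κ κ' * supNorm (blk (bj ℓ j) x'.1 - y.1))) := by
    intro y
    simp only [hg₂]
    split_ifs with hle
    · rw [abs_zero]
      positivity
    · refine (hg y).trans (le_of_eq ?_)
      rw [min_eq_right (le_of_lt (not_le.1 hle))]
  -- the column-differenced right factor `B′(y′, z) = L^k(B_j(y′, fwd z) − B_j(y′, z))`
  have hB : ∀ (y' : ↥(boxDom (Mj ℓ k M j))) (z : ↥(boxDom (Nf ℓ k M))),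
      |(Matrix.of fun (y' : ↥(boxDom (Mj ℓ k M j))) (z : ↥(boxDom (Nf ℓ k M))) =>
          (((ℓ + 1) ^ k : ℕ) : ℝ) * (Bmat ℓ k M j a m2 y' (fwd (Nf ℓ k M) μ z) - Bmat ℓ k M j a m2 y' z)) y' z|
        ≤ ((((bj ℓ j : ℕ) : ℝ)) ^ (d + 1))⁻¹ *
          ((sc ℓ k j)⁻¹ * C' * Real.exp (-(min κ κ' * supNorm (blk (bj ℓ j) z.1 - y'.1)))) := by
    intro y' z
    rw [Matrix.of_apply]
    exact (hDc k j hj1 hj a m2 h1 h2 h3 h4 M hM μ y' z).trans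
      (mul_le_mul_of_nonneg_left
        (mul_le_mul_of_nonneg_left (exp_rate_mono (min_le_right κ κ') (supNorm_nonneg _))
          (mul_nonneg hs1i.le hC'))
        (inv_pos.2 hbD).le)
  have hC : ∀ (y y' : ↥(boxDom (Mj ℓ k M j))),
      |Cmat ℓ k M j a m2 y y'| ≤ (sc ℓ k j ^ 2)⁻¹ * c₂ * Real.exp (-(δ * supNorm (y.1 - y'.1))) := by
    intro y y'
    have h := (hCov (bj ℓ j) hb1 _ _ a hw1 hw2 hm' hm'' h1 h2 (Mp ℓ k M j) (Mp_pos hM)).2 y y'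
    rw [Cmat, Matrix.smul_apply, smul_eq_mul, abs_mul, abs_of_pos hsi, mul_assoc]
    exact mul_le_mul_of_nonneg_left h hsi.le
  -- the two triple-product estimates, about `x` and about `x′`
  have htri1 := wsum_gCB_le hj M x g₁ (Cmat ℓ k M j a m2)
    (Matrix.of fun (y' : ↥(boxDom (Mj ℓ k M j))) (z : ↥(boxDom (Nf ℓ k M))) =>
      (((ℓ + 1) ^ k : ℕ) : ℝ) * (Bmat ℓ k M j a m2 y' (fwd (Nf ℓ k M) μ z) - Bmat ℓ k M j a m2 y' z))
    hP0 (mul_nonneg hsi.le hc₂.le) (mul_nonneg hs1i.le hC') hκ₁ hδ hδ0 hδκ hδδ hg1 hC hB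
  have htri2 := wsum_gCB_le hj M x' g₂ (Cmat ℓ k M j a m2)
    (Matrix.of fun (y' : ↥(boxDom (Mj ℓ k M j))) (z : ↥(boxDom (Nf ℓ k M))) =>
      (((ℓ + 1) ^ k : ℕ) : ℝ) * (Bmat ℓ k M j a m2 y' (fwd (Nf ℓ k M) μ z) - Bmat ℓ k M j a m2 y' z))
    hP0 (mul_nonneg hsi.le hc₂.le) (mul_nonneg hs1i.le hC') hκ₁ hδ hδ0 hδκ hδδ hg2 hC hB
  -- the weighted mixed difference of the row pair of `α_j²A_jC_jB_j`
  have hfun : (fun z => W * ((((ℓ + 1) ^ k : ℕ) : ℝ) *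
        (((Gfine ℓ k M (j + 1) a m2 - Gfine ℓ k M j a m2) x' (fwd (Nf ℓ k M) μ z)
            - (Gfine ℓ k M (j + 1) a m2 - Gfine ℓ k M j a m2) x' z)
          - ((Gfine ℓ k M (j + 1) a m2 - Gfine ℓ k M j a m2) x (fwd (Nf ℓ k M) μ z)
            - (Gfine ℓ k M (j + 1) a m2 - Gfine ℓ k M j a m2) x z))))
      = fun z => αj a ℓ k j ^ 2 *
          ((∑ y', ∑ y, g₁ y * Cmat ℓ k M j a m2 y y'
              * (Matrix.of fun (y' : ↥(boxDom (Mj ℓ k M j))) (z : ↥(boxDom (Nf ℓ k M))) =>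
                  (((ℓ + 1) ^ k : ℕ) : ℝ) *
                    (Bmat ℓ k M j a m2 y' (fwd (Nf ℓ k M) μ z) - Bmat ℓ k M j a m2 y' z)) y' z)
          + (∑ y', ∑ y, g₂ y * Cmat ℓ k M j a m2 y y'
              * (Matrix.of fun (y' : ↥(boxDom (Mj ℓ k M j))) (z : ↥(boxDom (Nf ℓ k M))) =>
                  (((ℓ + 1) ^ k : ℕ) : ℝ) *
                    (Bmat ℓ k M j a m2 y' (fwd (Nf ℓ k M) μ z) - Bmat ℓ k M j a m2 y' z)) y' z)) := by
    funext z
    simp only [Matrix.of_apply]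
    rw [Gfine_succ_sub hℓ hj1 hj hM ha0 h3, weight_mul3_rowsub_coldiff, ← Finset.sum_add_distrib]
    congr 1
    refine Finset.sum_congr rfl fun y' _ => ?_
    rw [← Finset.sum_add_distrib]
    refine Finset.sum_congr rfl fun y _ => ?_
    have h12 := hg12 y
    rw [hgL] at h12
    simp only at h12
    rw [h12]
    ring
  have hα : αj a ℓ k j ^ 2 ≤ aplus ^ 2 * (sc ℓ k j ^ 2) ^ 2 := by
    unfold αj
    rw [mul_pow]
    exact mul_le_mul_of_nonneg_right (pow_le_pow_left₀ hapos.le hw2 2) (by positivity)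
  rw [hfun, wsum2_mul_left _ _ _ _ (sq_nonneg _)]
  have hw2 := (wsum2_add_le δ₀ ((ℓ + 1) ^ k) x x'
      (fun z => ∑ y', ∑ y, g₁ y * Cmat ℓ k M j a m2 y y'
        * (Matrix.of fun (y' : ↥(boxDom (Mj ℓ k M j))) (z : ↥(boxDom (Nf ℓ k M))) =>
            (((ℓ + 1) ^ k : ℕ) : ℝ) * (Bmat ℓ k M j a m2 y' (fwd (Nf ℓ k M) μ z) - Bmat ℓ k M j a m2 y' z)) y' z)
      (fun z => ∑ y', ∑ y, g₂ y * Cmat ℓ k M j a m2 y y'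
        * (Matrix.of fun (y' : ↥(boxDom (Mj ℓ k M j))) (z : ↥(boxDom (Nf ℓ k M))) =>
            (((ℓ + 1) ^ k : ℕ) : ℝ) *
              (Bmat ℓ k M j a m2 y' (fwd (Nf ℓ k M) μ z) - Bmat ℓ k M j a m2 y' z)) y' z)).trans
    (add_le_add (wsum2_le_wsum_left hδ0 _ x x' _) (wsum2_le_wsum_right hδ0 _ x x' _))
  calc αj a ℓ k j ^ 2 * wsum2 δ₀ ((ℓ + 1) ^ k) x x'
        (fun z => (∑ y', ∑ y, g₁ y * Cmat ℓ k M j a m2 y y'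
            * (Matrix.of fun (y' : ↥(boxDom (Mj ℓ k M j))) (z : ↥(boxDom (Nf ℓ k M))) =>
                (((ℓ + 1) ^ k : ℕ) : ℝ) *
                  (Bmat ℓ k M j a m2 y' (fwd (Nf ℓ k M) μ z) - Bmat ℓ k M j a m2 y' z)) y' z)
          + (∑ y', ∑ y, g₂ y * Cmat ℓ k M j a m2 y y'
            * (Matrix.of fun (y' : ↥(boxDom (Mj ℓ k M j))) (z : ↥(boxDom (Nf ℓ k M))) =>
                (((ℓ + 1) ^ k : ℕ) : ℝ) *
                  (Bmat ℓ k M j a m2 y' (fwd (Nf ℓ k M) μ z) - Bmat ℓ k M j a m2 y' z)) y' z))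
      ≤ (aplus ^ 2 * (sc ℓ k j ^ 2) ^ 2) *
          (sc ℓ k j ^ α * (sc ℓ k j ^ 2)⁻¹ * C₁ * ((sc ℓ k j ^ 2)⁻¹ * c₂) * ((sc ℓ k j)⁻¹ * C')
              * Real.exp δ₀ * (latticeConst (d + 1) (min κ κ' / 2) * latticeConst (d + 1) (δ / 2)
                  * latticeConst (d + 1) (min κ κ' / 2))
            + sc ℓ k j ^ α * (sc ℓ k j ^ 2)⁻¹ * C₁ * ((sc ℓ k j ^ 2)⁻¹ * c₂) * ((sc ℓ k j)⁻¹ * C')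
              * Real.exp δ₀ * (latticeConst (d + 1) (min κ κ' / 2) * latticeConst (d + 1) (δ / 2)
                  * latticeConst (d + 1) (min κ κ' / 2))) :=
        mul_le_mul hα (hw2.trans (add_le_add htri1 htri2)) (wsum2_nonneg _ _ _ _ _) (by positivity)
    _ = 2 * (aplus ^ 2 * (C₁ * c₂ * C')
          * (latticeConst (d + 1) (min κ κ' / 2) * latticeConst (d + 1) (δ / 2)
              * latticeConst (d + 1) (min κ κ' / 2)))
          * Real.exp δ₀ * (sc ℓ k j ^ α * (sc ℓ k j)⁻¹) := by
        field_simp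
        ring

end StepBound

set_option maxHeartbeats 1600000 in
/-- **The master column Hölder row-sum estimate over the scales `j ≤ k`, rate uniform in `α`** — `B4Thm19ZeroBoxHolderDual.Gfine_rowwHT_bound` in print's order: ONE `δ₀ = min(r/2, κ₀)` for all `α`; the constant carries the series `q(α)/(1 − q(α))` of (2.39). [cite: Balaban1983RegularityDecay, (2.38)–(2.39) pp.582–583, Thm (1.9) p.573] -/
theorem Gfine_rowwHT_bound_unif (d ℓ : ℕ) (hℓ : 1 ≤ ℓ) (amin aplus m2plus : ℝ) (ha : 0 < amin) :
    ∃ δ₀ : ℝ, 0 < δ₀ ∧ ∀ (α : ℝ), 0 ≤ α → α < 1 → ∃ c₀ : ℝ, 0 < c₀ ∧ ∀ (k : ℕ), 1 ≤ k → ∀ (j : ℕ), 1 ≤ j → j ≤ k →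
      ∀ (a m2 : ℝ), amin ≤ a → a ≤ aplus → 0 ≤ m2 → m2 ≤ m2plus → ∀ (M : Fin (d + 1) → ℕ),
        (∀ i, 1 ≤ M i) → ∀ (μ : Fin (d + 1)) (x x' : ↥(boxDom (Nf ℓ k M))), x'.1 ≠ x.1 →
          wsum2 δ₀ ((ℓ + 1) ^ k) x x' (fun z => ((((ℓ + 1) ^ k : ℕ) : ℝ) / supNorm (x'.1 - x.1)) ^ α *
              ((((ℓ + 1) ^ k : ℕ) : ℝ) *
                ((Gfine ℓ k M j a m2 x' (fwd (Nf ℓ k M) μ z) - Gfine ℓ k M j a m2 x' z)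
                  - (Gfine ℓ k M j a m2 x (fwd (Nf ℓ k M) μ z) - Gfine ℓ k M j a m2 x z)))) ≤ c₀ := by
  obtain ⟨r, C₀, hr, hC₀, hdec⟩ := boxOpR_L_inv_decay d ℓ hℓ (amin * (1 - ((((ℓ : ℝ) + 1)) ^ 2)⁻¹))
    aplus m2plus (aminus'_pos hℓ ha)
  obtain ⟨κ₀, hκ₀, hstepA⟩ := step_termHT_bound_unif d ℓ hℓ amin aplus m2plus ha
  set δ₀ : ℝ := min (r / 2) κ₀ with hδ₀
  have hδ0 : 0 < δ₀ := lt_min (half_pos hr) hκ₀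
  have hδr : δ₀ ≤ r / 2 := min_le_left _ _
  have hδκ : δ₀ ≤ κ₀ := min_le_right _ _
  have hK1 := one_le_latticeConst d (half_pos hr)
  have hL0 : (0 : ℝ) < (ℓ : ℝ) + 1 := by positivity
  set B₁ : ℝ := 2 * (((ℓ : ℝ) + 1) ^ 2 * C₀ * (Real.exp r + 1) * latticeConst (d + 1) (r / 2)) with hB₁
  have hB₁0 : 0 < B₁ := by positivity
  refine ⟨δ₀, hδ0, fun α hα0 hα1 => ?_⟩
  obtain ⟨Θ, hΘ, hstep⟩ := hstepA α hα0 hα1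
  set q : ℝ := ((ℓ : ℝ) + 1) ^ α * (((ℓ : ℝ) + 1))⁻¹ with hq
  have hq0 : 0 < q := by positivity
  have hq1' : q < 1 := Lratio_lt_one hℓ hα1
  have hq1 : 0 < 1 - q := by linarith
  have hΘe : 0 ≤ Θ * Real.exp δ₀ := by positivity
  refine ⟨B₁ + Θ * Real.exp δ₀ * (q / (1 - q)),
    by linarith [mul_nonneg hΘe (div_nonneg hq0.le hq1.le)], ?_⟩
  intro k hk j hj1 hjk a m2 h1 h2 h3 h4 M hM
  have ha0 : 0 < a := lt_of_lt_of_le ha h1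
  have hnk : 1 ≤ (ℓ + 1) ^ k := Nat.one_le_pow _ _ (by omega)
  have hn0 : (0 : ℝ) ≤ (((ℓ + 1) ^ k : ℕ) : ℝ) := Nat.cast_nonneg _
  -- the base: entries of `𝒢_1`, scaled by `(L^k)²`
  obtain ⟨hw1, hw2, hapos⟩ := aSeq_window hℓ ha h1 h2 (le_refl 1)
  have hT : ∀ p q' : ↥(boxDom (Nf ℓ k M)),
      (((ℓ + 1) ^ k : ℕ) : ℝ) * ((((ℓ + 1) ^ k : ℕ) : ℝ) * |Gfine ℓ k M 1 a m2 p q'|)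
        ≤ ((ℓ : ℝ) + 1) ^ 2 * C₀ * Real.exp (-(r * supNorm (p.1 - q'.1))) := by
    intro p q'
    rcases Nat.lt_or_ge k 2 with hk2 | hk2
    · obtain rfl : k = 1 := by omega
      have hG : Gfine ℓ 1 M 1 a m2 = (boxOpR ((ℓ + 1) ^ 1) (B1.aSeq a ((ℓ : ℝ) + 1) 1) m2 M)⁻¹ := by
        unfold Gfine
        rw [fineOp_top]
      rw [hG]
      have hd := hdec ((ℓ + 1) ^ 1) (pow_one _) _ _ hw1 hw2 h3 h4 M p q'
      have hc1 : (((ℓ + 1) ^ 1 : ℕ) : ℝ) = (ℓ : ℝ) + 1 := by push_cast; ring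
      rw [hc1, ← mul_assoc, ← sq]
      exact (mul_le_mul_of_nonneg_left hd (by positivity)).trans (le_of_eq (by ring))
    · have hs : 0 < sc ℓ k 1 ^ 2 := pow_pos (sc_pos ℓ k 1) 2
      have hm' : 0 ≤ m2 / sc ℓ k 1 ^ 2 := div_nonneg h3 hs.le
      have hm'' : m2 / sc ℓ k 1 ^ 2 ≤ m2plus :=
        (div_le_self h3 (one_le_pow₀ (one_le_sc ℓ k 1))).trans h4
      rw [Gfine_apply hℓ (le_refl 1) hk2 hM ha0 h3 p q', abs_mul, abs_of_pos (inv_pos.2 hs), ← mul_assoc,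
        ← mul_assoc, Lk_sq_mul_sc_one_sq_inv hk]
      have hd := hdec (bj ℓ 1) (pow_one _) _ _ hw1 hw2 hm' hm'' (Mj ℓ k M 1)
        ((ej ℓ k M 1 hk2).symm p) ((ej ℓ k M 1 hk2).symm q')
      have hpv : ((ej ℓ k M 1 hk2).symm p).1 = p.1 := rfl
      have hqv : ((ej ℓ k M 1 hk2).symm q').1 = q'.1 := rfl
      rw [hpv, hqv] at hd
      exact (mul_le_mul_of_nonneg_left hd (by positivity)).trans (le_of_eq (by ring))
  -- the base: column-differenced entries of one row against a weight `w ≤ L^k`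
  have hTD : ∀ (μ : Fin (d + 1)) (p : ↥(boxDom (Nf ℓ k M))) (w : ℝ), 0 ≤ w → w ≤ (((ℓ + 1) ^ k : ℕ) : ℝ) →
      ∀ z : ↥(boxDom (Nf ℓ k M)),
        |w * ((((ℓ + 1) ^ k : ℕ) : ℝ) * (Gfine ℓ k M 1 a m2 p (fwd (Nf ℓ k M) μ z) - Gfine ℓ k M 1 a m2 p z))|
          ≤ ((ℓ : ℝ) + 1) ^ 2 * C₀ * (Real.exp r + 1) * Real.exp (-(r * supNorm (p.1 - z.1))) := by
    intro μ p w hw0 hwn z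
    have h1' := hT p (fwd (Nf ℓ k M) μ z)
    have h2' := hT p z
    have hnb := supNorm_sub_le_sub_fwd μ p z
    have he : Real.exp (-(r * supNorm (p.1 - (fwd (Nf ℓ k M) μ z).1)))
        ≤ Real.exp r * Real.exp (-(r * supNorm (p.1 - z.1))) := by
      rw [← Real.exp_add]
      exact Real.exp_le_exp.2 (by nlinarith)
    have hLC : 0 ≤ ((ℓ : ℝ) + 1) ^ 2 * C₀ := by positivity
    calc |w * ((((ℓ + 1) ^ k : ℕ) : ℝ) * (Gfine ℓ k M 1 a m2 p (fwd (Nf ℓ k M) μ z) - Gfine ℓ k M 1 a m2 p z))|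
        = w * ((((ℓ + 1) ^ k : ℕ) : ℝ) * |Gfine ℓ k M 1 a m2 p (fwd (Nf ℓ k M) μ z) - Gfine ℓ k M 1 a m2 p z|) := by
          rw [abs_mul, abs_mul, abs_of_nonneg hw0, abs_of_nonneg hn0]
      _ ≤ (((ℓ + 1) ^ k : ℕ) : ℝ) * ((((ℓ + 1) ^ k : ℕ) : ℝ) *
            (|Gfine ℓ k M 1 a m2 p (fwd (Nf ℓ k M) μ z)| + |Gfine ℓ k M 1 a m2 p z|)) :=
          mul_le_mul hwn (mul_le_mul_of_nonneg_left (abs_sub _ _) hn0) (by positivity) hn0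
      _ = (((ℓ + 1) ^ k : ℕ) : ℝ) * ((((ℓ + 1) ^ k : ℕ) : ℝ) * |Gfine ℓ k M 1 a m2 p (fwd (Nf ℓ k M) μ z)|)
            + (((ℓ + 1) ^ k : ℕ) : ℝ) * ((((ℓ + 1) ^ k : ℕ) : ℝ) * |Gfine ℓ k M 1 a m2 p z|) := by ring
      _ ≤ ((ℓ : ℝ) + 1) ^ 2 * C₀ * Real.exp (-(r * supNorm (p.1 - (fwd (Nf ℓ k M) μ z).1)))
            + ((ℓ : ℝ) + 1) ^ 2 * C₀ * Real.exp (-(r * supNorm (p.1 - z.1))) := add_le_add h1' h2'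
      _ ≤ ((ℓ : ℝ) + 1) ^ 2 * C₀ * (Real.exp r * Real.exp (-(r * supNorm (p.1 - z.1))))
            + ((ℓ : ℝ) + 1) ^ 2 * C₀ * Real.exp (-(r * supNorm (p.1 - z.1))) :=
          add_le_add (mul_le_mul_of_nonneg_left he hLC) le_rfl
      _ = _ := by ring
  -- the inductive claim
  have main : ∀ j, 1 ≤ j → j ≤ k → ∀ (μ : Fin (d + 1)) (x x' : ↥(boxDom (Nf ℓ k M))), x'.1 ≠ x.1 →
      wsum2 δ₀ ((ℓ + 1) ^ k) x x' (fun z => ((((ℓ + 1) ^ k : ℕ) : ℝ) / supNorm (x'.1 - x.1)) ^ α *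
          ((((ℓ + 1) ^ k : ℕ) : ℝ) *
            ((Gfine ℓ k M j a m2 x' (fwd (Nf ℓ k M) μ z) - Gfine ℓ k M j a m2 x' z)
              - (Gfine ℓ k M j a m2 x (fwd (Nf ℓ k M) μ z) - Gfine ℓ k M j a m2 x z))))
        ≤ B₁ + Θ * Real.exp δ₀ * (q * (sc ℓ k j ^ α * (sc ℓ k j)⁻¹) / (1 - q)) := by
    intro j hj1
    induction j, hj1 using Nat.le_induction with
    | base =>
      intro _ μ x x' hne
      have hσ1 : 1 ≤ supNorm (x'.1 - x.1) := one_le_supNorm (sub_ne_zero.2 hne)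
      have hW0 : 0 ≤ ((((ℓ + 1) ^ k : ℕ) : ℝ) / supNorm (x'.1 - x.1)) ^ α :=
        Real.rpow_nonneg (div_nonneg hn0 (le_trans zero_le_one hσ1)) α
      have hWn := holderWeight_le hnk hσ1 hα0 hα1.le
      have hB0 : 0 ≤ ((ℓ : ℝ) + 1) ^ 2 * C₀ * (Real.exp r + 1) := by positivity
      have hg₁ : ∀ z : ↥(boxDom (Nf ℓ k M)),
          |-(((((ℓ + 1) ^ k : ℕ) : ℝ) / supNorm (x'.1 - x.1)) ^ α *
              ((((ℓ + 1) ^ k : ℕ) : ℝ) * (Gfine ℓ k M 1 a m2 x (fwd (Nf ℓ k M) μ z) - Gfine ℓ k M 1 a m2 x z)))|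
            ≤ ((ℓ : ℝ) + 1) ^ 2 * C₀ * (Real.exp r + 1) * Real.exp (-(r * supNorm (x.1 - z.1))) := by
        intro z
        rw [abs_neg]
        exact hTD μ x _ hW0 hWn z
      have hg₂ : ∀ z : ↥(boxDom (Nf ℓ k M)),
          |((((ℓ + 1) ^ k : ℕ) : ℝ) / supNorm (x'.1 - x.1)) ^ α *
              ((((ℓ + 1) ^ k : ℕ) : ℝ) * (Gfine ℓ k M 1 a m2 x' (fwd (Nf ℓ k M) μ z) - Gfine ℓ k M 1 a m2 x' z))|
            ≤ ((ℓ : ℝ) + 1) ^ 2 * C₀ * (Real.exp r + 1) * Real.exp (-(r * supNorm (x'.1 - z.1))) :=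
        fun z => hTD μ x' _ hW0 hWn z
      have hsplit := wsum2_split_le hδ0.le ((ℓ + 1) ^ k) x x'
        (fun z => ((((ℓ + 1) ^ k : ℕ) : ℝ) / supNorm (x'.1 - x.1)) ^ α *
          ((((ℓ + 1) ^ k : ℕ) : ℝ) *
            ((Gfine ℓ k M 1 a m2 x' (fwd (Nf ℓ k M) μ z) - Gfine ℓ k M 1 a m2 x' z)
              - (Gfine ℓ k M 1 a m2 x (fwd (Nf ℓ k M) μ z) - Gfine ℓ k M 1 a m2 x z))))
        (fun z => -(((((ℓ + 1) ^ k : ℕ) : ℝ) / supNorm (x'.1 - x.1)) ^ α *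
          ((((ℓ + 1) ^ k : ℕ) : ℝ) * (Gfine ℓ k M 1 a m2 x (fwd (Nf ℓ k M) μ z) - Gfine ℓ k M 1 a m2 x z))))
        (fun z => ((((ℓ + 1) ^ k : ℕ) : ℝ) / supNorm (x'.1 - x.1)) ^ α *
          ((((ℓ + 1) ^ k : ℕ) : ℝ) * (Gfine ℓ k M 1 a m2 x' (fwd (Nf ℓ k M) μ z) - Gfine ℓ k M 1 a m2 x' z)))
        (fun z => by ring)
      have hpos : 0 ≤ Θ * Real.exp δ₀ * (q * (sc ℓ k 1 ^ α * (sc ℓ k 1)⁻¹) / (1 - q)) :=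
        mul_nonneg hΘe (div_nonneg (mul_nonneg hq0.le (mul_nonneg (Real.rpow_nonneg (sc_pos ℓ k 1).le α)
          (inv_pos.2 (sc_pos ℓ k 1)).le)) hq1.le)
      calc _ ≤ _ := hsplit
        _ ≤ ((ℓ : ℝ) + 1) ^ 2 * C₀ * (Real.exp r + 1) * latticeConst (d + 1) (r / 2)
              + ((ℓ : ℝ) + 1) ^ 2 * C₀ * (Real.exp r + 1) * latticeConst (d + 1) (r / 2) :=
            add_le_add (wsum_le_of_decay hnk x hB0 hr hδ0.le hδr hg₁)
              (wsum_le_of_decay hnk x' hB0 hr hδ0.le hδr hg₂)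
        _ = B₁ := by rw [hB₁]; ring
        _ ≤ B₁ + Θ * Real.exp δ₀ * (q * (sc ℓ k 1 ^ α * (sc ℓ k 1)⁻¹) / (1 - q)) := by linarith
    | succ j hj1 ih =>
      intro hjk μ x x' hne
      have hprev := ih (by omega) μ x x' hne
      have hst := hstep δ₀ hδ0.le hδκ k j hj1 hjk a m2 h1 h2 h3 h4 M hM μ x x' hne
      have hsplit : (fun z => ((((ℓ + 1) ^ k : ℕ) : ℝ) / supNorm (x'.1 - x.1)) ^ α *
            ((((ℓ + 1) ^ k : ℕ) : ℝ) *
              ((Gfine ℓ k M (j + 1) a m2 x' (fwd (Nf ℓ k M) μ z) - Gfine ℓ k M (j + 1) a m2 x' z)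
                - (Gfine ℓ k M (j + 1) a m2 x (fwd (Nf ℓ k M) μ z) - Gfine ℓ k M (j + 1) a m2 x z))))
          = fun z => ((((ℓ + 1) ^ k : ℕ) : ℝ) / supNorm (x'.1 - x.1)) ^ α *
              ((((ℓ + 1) ^ k : ℕ) : ℝ) *
                (((Gfine ℓ k M (j + 1) a m2 - Gfine ℓ k M j a m2) x' (fwd (Nf ℓ k M) μ z)
                    - (Gfine ℓ k M (j + 1) a m2 - Gfine ℓ k M j a m2) x' z)
                  - ((Gfine ℓ k M (j + 1) a m2 - Gfine ℓ k M j a m2) x (fwd (Nf ℓ k M) μ z)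
                    - (Gfine ℓ k M (j + 1) a m2 - Gfine ℓ k M j a m2) x z)))
            + ((((ℓ + 1) ^ k : ℕ) : ℝ) / supNorm (x'.1 - x.1)) ^ α *
              ((((ℓ + 1) ^ k : ℕ) : ℝ) *
                ((Gfine ℓ k M j a m2 x' (fwd (Nf ℓ k M) μ z) - Gfine ℓ k M j a m2 x' z)
                  - (Gfine ℓ k M j a m2 x (fwd (Nf ℓ k M) μ z) - Gfine ℓ k M j a m2 x z))) := by
        funext z
        simp only [Matrix.sub_apply]
        ring
      rw [hsplit]
      calc _ ≤ _ := wsum2_add_le _ _ _ _ _ _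
        _ ≤ Θ * Real.exp δ₀ * (sc ℓ k j ^ α * (sc ℓ k j)⁻¹)
              + (B₁ + Θ * Real.exp δ₀ * (q * (sc ℓ k j ^ α * (sc ℓ k j)⁻¹) / (1 - q))) :=
            add_le_add hst hprev
        _ = B₁ + Θ * Real.exp δ₀ * (q * (sc ℓ k (j + 1) ^ α * (sc ℓ k (j + 1))⁻¹) / (1 - q)) := by
            rw [sc_rpow_mul_inv_succ hjk α, ← hq]
            field_simp
            ring
  intro μ x x' hne
  have hm := main j hj1 hjk μ x x' hne
  have hs1 : sc ℓ k j ^ α * (sc ℓ k j)⁻¹ ≤ 1 := sc_rpow_mul_inv_le_one ℓ k j hα1.le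
  have hgeo : q * (sc ℓ k j ^ α * (sc ℓ k j)⁻¹) / (1 - q) ≤ q / (1 - q) :=
    div_le_div_of_nonneg_right (mul_le_of_le_one_right hq0.le hs1) hq1.le
  have hfin := mul_le_mul_of_nonneg_left hgeo hΘe
  linarith

/-! ## §3 The column companion of (1.9) at `A = 0` on boxes in print's quantifier order -/

/-- **THE COLUMN COMPANION OF (1.9) AT `A = 0` ON BOXES WITH THE PRINTED QUANTIFIER ORDER** («δ₀ … depending on d, M only, c₀ on α also», p. 573): `∃ δ₀ > 0 ∀ α ∈ [0,1) ∃ c₀(α) > 0 …: Σ_z (L^k/|x′−x|_∞)^α·|L^k((G(x′,fwd z) − G(x′,z)) − (G(x,fwd z) − G(x,z)))|·e^{δ₀min/L^k} ≤ c₀(α)` — `B4Thm19ZeroBoxHolderDual.thm19Dual_zero_box_roww` re-threaded. [cite: Balaban1983RegularityDecay, Theorem (Prop. 2.1 of [1]) (1.9) p.573; Lemma 2.4 (2.36) p.582] -/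
theorem thm19Dual_zero_box_roww_unif (d ℓ : ℕ) (hℓ : 1 ≤ ℓ) (amin aplus m2plus : ℝ) (ha : 0 < amin) :
    ∃ δ₀ : ℝ, 0 < δ₀ ∧ ∀ (α : ℝ), 0 ≤ α → α < 1 → ∃ c₀ : ℝ, 0 < c₀ ∧ ∀ (k : ℕ), 1 ≤ k → ∀ (a m2 : ℝ), amin ≤ a → a ≤ aplus → 0 ≤ m2 →
      m2 ≤ m2plus → ∀ (M : Fin (d + 1) → ℕ), (∀ i, 1 ≤ M i) →
        ∀ (μ : Fin (d + 1)) (x x' : ↥(boxDom (fun i => (ℓ + 1) ^ k * M i))), x'.1 ≠ x.1 →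
          ∑ z, |((((ℓ + 1) ^ k : ℕ) : ℝ) / supNorm (x'.1 - x.1)) ^ α * ((((ℓ + 1) ^ k : ℕ) : ℝ) *
                (((boxOpR ((ℓ + 1) ^ k) (B1.aSeq a ((ℓ : ℝ) + 1) k) m2 M)⁻¹ x'
                      (fwd (fun i => (ℓ + 1) ^ k * M i) μ z)
                    - (boxOpR ((ℓ + 1) ^ k) (B1.aSeq a ((ℓ : ℝ) + 1) k) m2 M)⁻¹ x' z)
                  - ((boxOpR ((ℓ + 1) ^ k) (B1.aSeq a ((ℓ : ℝ) + 1) k) m2 M)⁻¹ x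
                      (fwd (fun i => (ℓ + 1) ^ k * M i) μ z)
                    - (boxOpR ((ℓ + 1) ^ k) (B1.aSeq a ((ℓ : ℝ) + 1) k) m2 M)⁻¹ x z)))|
              * Real.exp (δ₀ * min (supNorm (x.1 - z.1)) (supNorm (x'.1 - z.1)) / (((ℓ + 1) ^ k : ℕ) : ℝ))
            ≤ c₀ := by
  obtain ⟨δ₀, hδ, hA⟩ := Gfine_rowwHT_bound_unif d ℓ hℓ amin aplus m2plus ha
  refine ⟨δ₀, hδ, fun α hα0 hα1 => ?_⟩
  obtain ⟨c₀, hc, h⟩ := hA α hα0 hα1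
  refine ⟨c₀, hc, fun k hk a m2 h1 h2 h3 h4 M hM μ x x' hne => ?_⟩
  have hG : Gfine ℓ k M k a m2 = (boxOpR ((ℓ + 1) ^ k) (B1.aSeq a ((ℓ : ℝ) + 1) k) m2 M)⁻¹ := by
    unfold Gfine
    rw [fineOp_top]
  have := h k hk k hk le_rfl a m2 h1 h2 h3 h4 M hM μ x x' hne
  rw [wsum2, hG] at this
  exact this

/-- **The column companion of (1.9) at `A = 0` with the LITERAL coefficient `a` of (1.6), printed quantifier order** — `B4Thm19ZeroBoxHolderDual.thm19Dual_zero_box_roww_coeff` re-threaded: `∃ δ₀ ∀ α ∃ c₀(α)`.  This is the form consumed by the [B6] two-level Hölder entry 5 `…B6Ineq243HolderDualTwoLevelBox.ineq243_twoLevel_holderDual_wsum2`. [cite: Balaban1983RegularityDecay, Theorem (Prop. 2.1 of [1]) (1.9) p.573 with (1.6) p.572] -/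
theorem thm19Dual_zero_box_roww_coeff_unif (d ℓ : ℕ) (hℓ : 1 ≤ ℓ) (amin aplus m2plus : ℝ) (ha : 0 < amin) :
    ∃ δ₀ : ℝ, 0 < δ₀ ∧ ∀ (α : ℝ), 0 ≤ α → α < 1 → ∃ c₀ : ℝ, 0 < c₀ ∧ ∀ (k : ℕ), 1 ≤ k → ∀ (a m2 : ℝ), amin ≤ a → a ≤ aplus → 0 ≤ m2 →
      m2 ≤ m2plus → ∀ (M : Fin (d + 1) → ℕ), (∀ i, 1 ≤ M i) →
        ∀ (μ : Fin (d + 1)) (x x' : ↥(boxDom (fun i => (ℓ + 1) ^ k * M i))), x'.1 ≠ x.1 →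
          ∑ z, |((((ℓ + 1) ^ k : ℕ) : ℝ) / supNorm (x'.1 - x.1)) ^ α * ((((ℓ + 1) ^ k : ℕ) : ℝ) *
                (((boxOpR ((ℓ + 1) ^ k) a m2 M)⁻¹ x' (fwd (fun i => (ℓ + 1) ^ k * M i) μ z)
                    - (boxOpR ((ℓ + 1) ^ k) a m2 M)⁻¹ x' z)
                  - ((boxOpR ((ℓ + 1) ^ k) a m2 M)⁻¹ x (fwd (fun i => (ℓ + 1) ^ k * M i) μ z)
                    - (boxOpR ((ℓ + 1) ^ k) a m2 M)⁻¹ x z)))|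
              * Real.exp (δ₀ * min (supNorm (x.1 - z.1)) (supNorm (x'.1 - z.1)) / (((ℓ + 1) ^ k : ℕ) : ℝ))
            ≤ c₀ := by
  obtain ⟨δ₀, hδ0, hA⟩ :=
    thm19Dual_zero_box_roww_unif d ℓ hℓ amin (aplus / (1 - ((((ℓ : ℝ) + 1)) ^ 2)⁻¹)) m2plus ha
  refine ⟨δ₀, hδ0, fun α hα0 hα1 => ?_⟩
  obtain ⟨c₀, hc0, h⟩ := hA α hα0 hα1
  refine ⟨c₀, hc0, ?_⟩
  intro k hk a m2 h1 h2 h3 h4 M hM μ x x' hne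
  obtain ⟨hr0, hr1⟩ := Linv_sq_bounds hℓ
  have hc := cK_pos hℓ hk
  have hA1 : amin ≤ a / cK ℓ k := by
    rw [le_div_iff₀ hc]
    calc amin * cK ℓ k ≤ amin * 1 := mul_le_mul_of_nonneg_left (cK_le_one hℓ hk) ha.le
      _ ≤ a := by linarith
  have hA2 : a / cK ℓ k ≤ aplus / (1 - ((((ℓ : ℝ) + 1)) ^ 2)⁻¹) :=
    div_le_div₀ (by linarith) h2 (by linarith) (oneSub_le_cK hℓ hk)
  have := h k hk (a / cK ℓ k) m2 hA1 hA2 h3 h4 M hM μ x x' hne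
  rwa [aSeq_div_cK hℓ hk] at this

end

end Literature.MathematicalPhysics.QuantumFieldTheory.Balaban1983to89.B4Thm19ZeroBoxHolderDualRateUnif
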